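import Literature.Analysis.FluidPDE.SteadyNSBoundedMild
import Literature.Analysis.FluidPDE.NSBoundedMildAnalytic
import HarnessLib

/-!
# Bounded steady Navier–Stokes flows on `ℝ³` are real-analytic

Analysis/FluidPDE proof file (theorems only; no named fact). The **bounded-velocity case** of
the classical interior analyticity of stationary Navier–Stokes flows (Masuda 1967, Kahane 1969;
Morrey 1958 for analytic non-linear elliptic systems), recorded in the tree as the named fact
`Literature.Uncategorized.SteadyNSRealAnalytic` (all smooth entire solutions, no bound):

* `IsSteadyClassicalNS.analyticOnNhd_of_bounded` — a steady classical solution `(W, P)` of the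
  unforced Navier–Stokes system at unit viscosity on `ℝ³` with `‖W‖ ≤ M` has a real-analytic
  velocity, `AnalyticOnNhd ℝ W univ`; no hypothesis on the pressure;
* `steadyNS_analyticOnNhd_of_bounded` — the same statement clause for clause in the coordinates
  of `Literature.Uncategorized.SteadyNSRealAnalytic` (`∑ᵢ (DW(X) eᵢ)ᵢ = 0`,
  `DW(X)(W X) + ∇P(X) = ∑ᵢ D(DW(·) eᵢ)(X) eᵢ`) plus the bound `‖W X‖ ≤ C`, i.e. exactly the
  clauses available in `Summit.AnomalousDissipation…DyadicWallCascade.WallProfileExists`.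

Proof (entirely inside the tree's Oseen architecture, no elliptic regularity): by
`IsSteadyClassicalNS.eq_heatExtension_sub_oseenDuhamel` (`SteadyNSBoundedMild.lean`) the steady
field solves `W = e^{tΔ}W − B¹₀(W,W)(t)` for every `t > 0`; by the PROVED local space–time
analyticity of Oseen's scheme from the bounded datum `W`
(`lemarieRieusset2016_local_analyticity_holds`, Lemarié-Rieusset 2016, Thm. 9.12) there is a
jointly real-analytic solution `v` of the same equation on a short window, bounded; bounded
solutions of Oseen's integral equation are unique (`oseenMild_bounded_unique`), so `W = v(t₀, ·)`
a.e., hence everywhere (continuity), and a time slice of a jointly analytic field is analytic.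

What is NOT here: unbounded velocities (the general fact `SteadyNSRealAnalytic` needs interior
analytic regularity for the ADN-elliptic stationary system, Morrey 1958, not in Mathlib), other
viscosities (reduce to `ν = 1` by `(W, P) ↦ (W/ν, P/ν²)`), domains other than `ℝ³`.

## References

* P. G. Lemarié-Rieusset, *The Navier–Stokes Problem in the 21st Century*, CRC Press 2016,
  Thm. 9.12 (PDF p. 260; proof pp. 260–263). [LemarieRieusset2016]
* C. Kahane, *On the spatial analyticity of solutions of the Navier–Stokes equations*, Arch.
  Rational Mech. Anal. 33 (1969) 386–405, Thm. (spatial analyticity). [Kahane1969]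
* K. Masuda, Proc. Japan Acad. 43 (1967) 827–832, Thm. 1. [Masuda1967]
* C. B. Morrey, Amer. J. Math. 80 (1958) 198–218 (Part I, interior analyticity). [Morrey1958]
* G. Koch, N. Nadirashvili, G. Seregin, V. Šverák, Acta Math. 203 (2009) = arXiv:0709.3599,
  Lemma 3.1. [KochNadirashviliSereginSverak2009]
-/

noncomputable section

open MeasureTheory Set Function Filter TopologicalSpace InnerProductSpace Metric
open _root_.Topology
open scoped ENNReal NNReal RealInnerProductSpace ContDiff Laplacian

namespace Literature.Analysis.FluidPDE

open UnboundedOperators (heatExtension)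

/-- **Bounded steady Navier–Stokes flows on `ℝ³` are real-analytic.** Let `(W, P)` be a steady
classical solution of the unforced Navier–Stokes system at unit viscosity on `ℝ³`
(`IsSteadyClassicalNS 1 0 W P`: `W`, `P` smooth, `(W·∇)W = ΔW − ∇P`, `div W = 0`) with
`‖W‖ ≤ M`. Then `W` is real-analytic on all of `ℝ³`. (Bounded case of Kahane 1969 / Masuda 1967;
proved here through Lemarié-Rieusset 2016, Thm. 9.12: the steady field is Oseen-mild,
`IsSteadyClassicalNS.eq_heatExtension_sub_oseenDuhamel`, and coincides with the real-analytic
local solution of Oseen's scheme from the datum `W` by uniqueness of bounded mild solutions.)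
[cite: LemarieRieusset2016, Thm. 9.12 (PDF p. 260; proof pp. 260–263)] -/
theorem IsSteadyClassicalNS.analyticOnNhd_of_bounded
    {W : EuclideanSpace ℝ (Fin 3) → EuclideanSpace ℝ (Fin 3)} {P : EuclideanSpace ℝ (Fin 3) → ℝ}
    (h : IsSteadyClassicalNS 1 0 W P) {M : ℝ} (hM : ∀ x, ‖W x‖ ≤ M) :
    AnalyticOnNhd ℝ W univ := by
  have hWc : Continuous W := h.smooth_velocity.continuous
  -- a positive bound
  set M₁ : ℝ := max M 1 with hM₁
  have hM₁0 : 0 < M₁ := lt_of_lt_of_le one_pos (le_max_right _ _)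
  have hM₁ : ∀ x, ‖W x‖ ≤ M₁ := fun x => (hM x).trans (le_max_left _ _)
  -- the local analytic solution of Oseen's scheme from the datum `W` at time `0`
  obtain ⟨ε, hε, CA, hCA, hloc⟩ := lemarieRieusset2016_local_analyticity_holds
  have hWess : eLpNorm W ∞ volume ≤ ENNReal.ofReal M₁ := by
    rw [eLpNorm_exponent_top]
    exact eLpNormEssSup_le_of_ae_bound (Eventually.of_forall hM₁)
  obtain ⟨v, hv_an, hv_eq, hv_bd⟩ := hloc one_pos 0 hM₁0 hWc.aestronglyMeasurable hWess
  set T : ℝ := 0 + ε * 1 / M₁ ^ 2 with hT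
  have hT0 : 0 < T := by rw [hT]; positivity
  -- uniqueness of bounded solutions of Oseen's integral equation on `(0, T)`
  set u : ℝ → EuclideanSpace ℝ (Fin 3) → EuclideanSpace ℝ (Fin 3) := fun _ => W
  set M' : ℝ := max M₁ (CA * M₁) with hM'
  have hM'0 : 0 ≤ M' := hM₁0.le.trans (le_max_left _ _)
  have hum : AEStronglyMeasurable (uncurry u)
      ((volume : Measure (ℝ × EuclideanSpace ℝ (Fin 3))).restrict (Ioo 0 T ×ˢ univ)) :=
    (hWc.comp continuous_snd).aestronglyMeasurable
  have hvm : AEStronglyMeasurable (uncurry v)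
      ((volume : Measure (ℝ × EuclideanSpace ℝ (Fin 3))).restrict (Ioo 0 T ×ˢ univ)) :=
    hv_an.continuousOn.aestronglyMeasurable (measurableSet_Ioo.prod MeasurableSet.univ)
  have huM : ∀ τ ∈ Ioo 0 T, ∀ y, ‖u τ y‖ ≤ M' := fun _ _ y => (hM₁ y).trans (le_max_left _ _)
  have hvM : ∀ τ ∈ Ioo 0 T, ∀ y, ‖v τ y‖ ≤ M' := fun τ hτ y =>
    (hv_bd τ hτ y).trans (le_max_right _ _)
  have hu : ∀ t ∈ Ioo 0 T, u t =ᵐ[volume] fun x =>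
      heatExtension W (1 * (t - 0)) x - oseenDuhamel 1 0 u u t x := fun t ht =>
    Eventually.of_forall fun x => by
      rw [one_mul, sub_zero]
      exact h.eq_heatExtension_sub_oseenDuhamel hM ht.1 x
  have hv : ∀ t ∈ Ioo 0 T, v t =ᵐ[volume] fun x =>
      heatExtension W (1 * (t - 0)) x - oseenDuhamel 1 0 v v t x := fun t ht =>
    Eventually.of_forall fun x => hv_eq t ht x
  have huniq := oseenMild_bounded_unique (U := fun t x => heatExtension W (1 * (t - 0)) x)
    one_pos hM'0 hum hvm huM hvM hu hv
  -- the slice at `t₀ = T/2`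
  have ht₀ : T / 2 ∈ Ioo 0 T := ⟨by positivity, by linarith⟩
  have hslice : AnalyticOnNhd ℝ (v (T / 2)) univ := by
    intro x _
    have hA : AnalyticAt ℝ (uncurry v) (T / 2, x) := hv_an _ ⟨ht₀, mem_univ _⟩
    have hι : AnalyticAt ℝ (fun y : EuclideanSpace ℝ (Fin 3) => ((T / 2 : ℝ), y)) x :=
      analyticAt_const.prod analyticAt_id
    exact hA.comp hι
  have hae : W =ᵐ[volume] v (T / 2) := huniq _ ht₀
  have heq : W = v (T / 2) :=
    (Continuous.ae_eq_iff_eq volume hWc hslice.continuous).1 hae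
  rw [heq]
  exact hslice

/-! ### Other viscosities -/

section Viscosity

variable {E : Type*} [NormedAddCommGroup E] [InnerProductSpace ℝ E] [FiniteDimensional ℝ E]

/-- **Viscosity normalisation for steady classical solutions**: if `(u, p)` solves the steady
system with viscosity `ν` and force `f`, then `(κu, κ²p)` solves it with viscosity `κν` and force
`κ²f` (every term is quadratic under the substitution; twin of `IsSteadyNSSolution.smul`,
`SteadyNSSolution.lean`). [folklore] -/
theorem IsSteadyClassicalNS.smul {ν : ℝ} {f u : E → E} {p : E → ℝ}
    (h : IsSteadyClassicalNS ν f u p) (κ : ℝ) :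
    IsSteadyClassicalNS (κ * ν) (κ ^ 2 • f) (κ • u) (κ ^ 2 • p) where
  smooth_velocity := h.smooth_velocity.const_smul κ
  smooth_pressure := h.smooth_pressure.const_smul (κ ^ 2)
  momentum y := by
    have hu2 : ContDiffAt ℝ 2 u y := (contDiff_infty.1 h.smooth_velocity 2).contDiffAt
    have hud : DifferentiableAt ℝ u y :=
      ((contDiff_infty.1 h.smooth_velocity 1).differentiable one_ne_zero) y
    have hpd : DifferentiableAt ℝ p y :=
      ((contDiff_infty.1 h.smooth_pressure 1).differentiable one_ne_zero) y
    have hΔ : (Δ (κ • u)) y = κ • (Δ u) y := InnerProductSpace.laplacian_smul κ hu2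
    have hc : convect (κ • u) (κ • u) y = κ ^ 2 • convect u u y := by
      simp only [convect, Pi.smul_def, fderiv_fun_const_smul hud, _root_.smul_apply, map_smul,
        smul_smul, pow_two]
    have hg : gradient (κ ^ 2 • p) y = κ ^ 2 • gradient p y := by
      have : (κ ^ 2 • p) = fun z => κ ^ 2 * p z := rfl
      rw [this, gradient, fderiv_const_mul hpd (κ ^ 2), gradient, map_smulₛₗ]
      simp
    rw [hΔ, hc, hg, Pi.smul_apply, h.momentum y]
    module
  divFree y := by
    have hud : DifferentiableAt ℝ u y :=
      ((contDiff_infty.1 h.smooth_velocity 1).differentiable one_ne_zero) y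
    have hD : fderiv ℝ (κ • u) y = κ • fderiv ℝ u y := fderiv_const_smul hud κ
    have h0 := h.divFree y
    rw [VectorCalculus.divergence] at h0 ⊢
    rw [hD, ContinuousLinearMap.toLinearMap_smul, map_smul, h0, smul_zero]

end Viscosity

/-- **Bounded steady Navier–Stokes flows on `ℝ³` are real-analytic, any viscosity `ν > 0`**
(reduction to `ν = 1` by `(W, P) ↦ (ν⁻¹W, ν⁻²P)`, `IsSteadyClassicalNS.smul`). [cite: LemarieRieusset2016, Thm. 9.12 (PDF p. 260; proof pp. 260–263)] -/
theorem IsSteadyClassicalNS.analyticOnNhd_of_bounded_of_pos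
    {W : EuclideanSpace ℝ (Fin 3) → EuclideanSpace ℝ (Fin 3)} {P : EuclideanSpace ℝ (Fin 3) → ℝ}
    {ν : ℝ} (hν : 0 < ν) (h : IsSteadyClassicalNS ν 0 W P) {M : ℝ} (hM : ∀ x, ‖W x‖ ≤ M) :
    AnalyticOnNhd ℝ W univ := by
  have h1 : IsSteadyClassicalNS 1 0 (ν⁻¹ • W) (ν⁻¹ ^ 2 • P) := by
    simpa [inv_mul_cancel₀ hν.ne'] using h.smul ν⁻¹
  have hb : ∀ x, ‖(ν⁻¹ • W) x‖ ≤ |ν⁻¹| * M := fun x => by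
    rw [Pi.smul_apply, norm_smul, Real.norm_eq_abs]
    exact mul_le_mul_of_nonneg_left (hM x) (abs_nonneg _)
  have hA := h1.analyticOnNhd_of_bounded hb
  have hW : W = ν • (ν⁻¹ • W) := by
    rw [smul_smul, mul_inv_cancel₀ hν.ne', one_smul]
  rw [hW]
  exact hA.const_smul

/-- **Bounded steady Navier–Stokes flows on `ℝ³` are real-analytic — coordinate form.** The
bounded-velocity case of `Literature.Uncategorized.SteadyNSRealAnalytic`, with its clauses
verbatim: for `W`, `P` of class `C^∞` on `ℝ³` with `∑ᵢ (DW(X) eᵢ)ᵢ = 0` (`div W = 0`),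
`DW(X)(W X) + ∇P(X) = ∑ᵢ D(DW(·) eᵢ)(X) eᵢ` (`(W·∇)W + ∇P = ΔW`) and `‖W X‖ ≤ C`, the velocity is
real-analytic, `AnalyticOnNhd ℝ W univ` (`eᵢ = EuclideanSpace.single i 1`; the sums are the
divergence and the Laplacian in the standard frame, `divergence_eq_sum_inner_fderiv`,
`laplacian_eq_sum_fderiv_fderiv`). [cite: LemarieRieusset2016, Thm. 9.12 (PDF p. 260; proof pp. 260–263)] -/
theorem steadyNS_analyticOnNhd_of_bounded
    (W : EuclideanSpace ℝ (Fin 3) → EuclideanSpace ℝ (Fin 3)) (P : EuclideanSpace ℝ (Fin 3) → ℝ)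
    (hW : ContDiff ℝ ((⊤ : ℕ∞) : WithTop ℕ∞) W) (hP : ContDiff ℝ ((⊤ : ℕ∞) : WithTop ℕ∞) P)
    (hdiv : ∀ X, ∑ i : Fin 3, (fderiv ℝ W X (EuclideanSpace.single i (1 : ℝ))) i = 0)
    (hNS : ∀ X, (fderiv ℝ W X) (W X) + gradient P X =
      ∑ i : Fin 3, fderiv ℝ (fun Y => fderiv ℝ W Y (EuclideanSpace.single i (1 : ℝ))) X
        (EuclideanSpace.single i (1 : ℝ)))
    {C : ℝ} (hC : ∀ X, ‖W X‖ ≤ C) :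
    AnalyticOnNhd ℝ W univ := by
  have hW2 : ContDiff ℝ 2 W := contDiff_infty.1 hW 2
  have hlap : ∀ X, (Δ W) X =
      ∑ i : Fin 3, fderiv ℝ (fun Y => fderiv ℝ W Y (EuclideanSpace.single i (1 : ℝ))) X
        (EuclideanSpace.single i (1 : ℝ)) := by
    intro X
    rw [laplacian_eq_sum_fderiv_fderiv (EuclideanSpace.basisFun (Fin 3) ℝ) hW2 X]
    simp only [EuclideanSpace.basisFun_apply]
  have hsteady : IsSteadyClassicalNS 1 0 W P :=
    { smooth_velocity := hW
      smooth_pressure := hP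
      momentum := fun X => by
        rw [convect_apply, one_smul, Pi.zero_apply, add_zero, hlap X, ← hNS X, add_sub_cancel_right]
      divFree := fun X => by
        rw [divergence_eq_sum_inner_fderiv (EuclideanSpace.basisFun (Fin 3) ℝ) W X]
        simpa only [EuclideanSpace.basisFun_apply, EuclideanSpace.inner_single_left, map_one,
          one_mul] using hdiv X }
  exact hsteady.analyticOnNhd_of_bounded hC

end Literature.Analysis.FluidPDE

end
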